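import Mathlib
import HarnessLib
import Summits.ValiantsHypothesis.ValiantsHypothesis.Theses.MonotoneRestoration

/-!
# Route MonotoneRestoration — support `CruxToTarget`

Item `stmt-ValiantsHypothesis-16196` (support of route `MonotoneRestoration`): the glue of the
mechanism into the thesis,

`MonotoneRestorationQP → SensitiveBridge → DenseSubtraction → NonnegRestorationQP`.

Given a matrix-symmetric nonnegative family `h` whose complexification is a VP family:
* `SensitiveBridge` (Hrubeš 2020, Thm 1: ε-monotonisation) gives, for every `n`, a degree
  `d n ≤ (n+2)^c₁`, an `ε n > 0` and a matrix-symmetric `g n ∈ ℝ≥0[x_ij]` with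
  `map (g n) = (1 + Σ x)^(d n) + ε n · map (h n)`, `totalDegree (g n) ≤ (n+2)^c₁` and monotone
  complexity `≤ (n+2)^c₁` (one family `g : (n : ℕ) → MvPolynomial (Fin n × Fin n) ℝ≥0`, chosen with
  `choose`);
* `MonotoneRestorationQP` applied to the family `g` gives square-symmetric circuits of size
  `≤ 2^((log₂ n + c₂)^c₂)` computing `map (g n)`;
* `DenseSubtraction` (Dawar–Wilsenach-style symmetric surgery) removes the dense symmetric part at
  cost `+ d n + n·n + 16` gates;
* the bookkeeping `2^((log₂ n + c₂)^c₂) + (n+2)^c₁ + n·n + 16 ≤ 2^((log₂ n + c₃)^c₃)` with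
  `c₃ := c₁ + c₂ + 4` (`monotoneRestoration_cruxToTarget_size_le`) finishes.

Sources: Hrubes2020 (Thm 1), DawarWilsenach2025. Pure logic and `Nat.log` arithmetic; no named
fact is used, nothing is vendored.
-/

-- single-problem summit: `Summit.ValiantsHypothesis.ValiantsHypothesis.…` is the namespace by design (D-0017)
set_option linter.dupNamespace false

namespace Summit.ValiantsHypothesis.ValiantsHypothesis.Theorems

open Summit.ValiantsHypothesis.ValiantsHypothesis.Theses.MonotoneRestoration

/-- Size bookkeeping for `monotoneRestoration_cruxToTarget_proof`: for all `c₁ c₂` there is `c₃`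
(namely `c₁ + c₂ + 4`) with `2^((log₂ n + c₂)^c₂) + (n+2)^c₁ + n·n + 16 ≤ 2^((log₂ n + c₃)^c₃)`
for every `n`.  Proof: with `L = log₂ n`, `B = L + c₃ ≥ 4` and `M = B^(c₁+c₂+3)`, each of the four
summands is `≤ 2^M` (using `n < 2^(L+1)`), and `4 · 2^M = 2^(M+2) ≤ 2^(M·B) = 2^(B^c₃)`.
[folklore] -/
theorem monotoneRestoration_cruxToTarget_size_le (c₁ c₂ : ℕ) : ∃ c₃ : ℕ, ∀ n : ℕ,
    2 ^ ((Nat.log 2 n + c₂) ^ c₂) + (n + 2) ^ c₁ + n * n + 16 ≤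
      2 ^ ((Nat.log 2 n + c₃) ^ c₃) := by
  refine ⟨c₁ + c₂ + 4, fun n => ?_⟩
  have hL : n < 2 ^ (Nat.log 2 n + 1) := Nat.lt_pow_succ_log_self Nat.one_lt_two n
  generalize Nat.log 2 n = L at hL ⊢
  set B : ℕ := L + (c₁ + c₂ + 4) with hB
  set M : ℕ := B ^ (c₁ + c₂ + 3) with hM
  have hB4 : 4 ≤ B := by omega
  have hB1 : 1 ≤ B := by omega
  have hBM : B ≤ M := by
    calc B = B ^ 1 := (pow_one B).symm
      _ ≤ B ^ (c₁ + c₂ + 3) := Nat.pow_le_pow_right hB1 (by omega)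
  have hM1 : 1 ≤ M := le_trans hB1 hBM
  have hB2M : B * B ≤ M := by
    calc B * B = B ^ 2 := (pow_two B).symm
      _ ≤ B ^ (c₁ + c₂ + 3) := Nat.pow_le_pow_right hB1 (by omega)
  -- the four summands are each at most `2 ^ M`
  have h1 : 2 ^ ((L + c₂) ^ c₂) ≤ 2 ^ M := by
    apply Nat.pow_le_pow_right (by norm_num)
    calc (L + c₂) ^ c₂ ≤ B ^ c₂ := Nat.pow_le_pow_left (by omega) c₂
      _ ≤ B ^ (c₁ + c₂ + 3) := Nat.pow_le_pow_right hB1 (by omega)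
  have h2 : (n + 2) ^ c₁ ≤ 2 ^ M := by
    have hn2 : n + 2 ≤ 2 ^ (L + 2) := by
      have h0 : 1 ≤ 2 ^ L := Nat.one_le_two_pow
      have h' : 2 ^ (L + 2) = 2 ^ L * 4 := by rw [pow_add]; norm_num
      have h'' : 2 ^ (L + 1) = 2 ^ L * 2 := by rw [pow_succ]
      omega
    have hexp : (L + 2) * c₁ ≤ M :=
      calc (L + 2) * c₁ ≤ B * B := Nat.mul_le_mul (by omega) (by omega)
        _ ≤ M := hB2M
    calc (n + 2) ^ c₁ ≤ (2 ^ (L + 2)) ^ c₁ := Nat.pow_le_pow_left hn2 c₁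
      _ = 2 ^ ((L + 2) * c₁) := (pow_mul 2 (L + 2) c₁).symm
      _ ≤ 2 ^ M := Nat.pow_le_pow_right (by norm_num) hexp
  have h3 : n * n ≤ 2 ^ M := by
    have hexp : (L + 1) + (L + 1) ≤ M :=
      calc (L + 1) + (L + 1) ≤ 4 * B := by omega
        _ ≤ B * B := Nat.mul_le_mul_right B hB4
        _ ≤ M := hB2M
    calc n * n ≤ 2 ^ (L + 1) * 2 ^ (L + 1) := Nat.mul_le_mul hL.le hL.le
      _ = 2 ^ ((L + 1) + (L + 1)) := (pow_add 2 _ _).symm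
      _ ≤ 2 ^ M := Nat.pow_le_pow_right (by norm_num) hexp
  have h4 : 16 ≤ 2 ^ M := by
    calc (16 : ℕ) = 2 ^ 4 := by norm_num
      _ ≤ 2 ^ M := Nat.pow_le_pow_right (by norm_num) (by omega)
  -- `4 · 2^M = 2^(M+2) ≤ 2^(M·B) = 2^(B^(c₁+c₂+4))`
  have hpow : B ^ (c₁ + c₂ + 4) = M * B := by
    rw [hM]; ring
  have hexp : M + 2 ≤ B ^ (c₁ + c₂ + 4) := by
    rw [hpow]
    calc M + 2 ≤ M * 4 := by omega
      _ ≤ M * B := Nat.mul_le_mul_left M hB4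
  calc 2 ^ ((L + c₂) ^ c₂) + (n + 2) ^ c₁ + n * n + 16
      ≤ 2 ^ M + 2 ^ M + 2 ^ M + 2 ^ M :=
        Nat.add_le_add (Nat.add_le_add (Nat.add_le_add h1 h2) h3) h4
    _ = 2 ^ (M + 2) := by ring
    _ ≤ 2 ^ (B ^ (c₁ + c₂ + 4)) := Nat.pow_le_pow_right (by norm_num) hexp

/-- **CruxToTarget** (item `stmt-ValiantsHypothesis-16196`, support of route MonotoneRestoration):
`MonotoneRestorationQP → SensitiveBridge → DenseSubtraction → NonnegRestorationQP`.
Apply `SensitiveBridge` to `h` (choosing one perturbed family `g`), `MonotoneRestorationQP` to `g`,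
`DenseSubtraction` to its square-symmetric circuits, and
`monotoneRestoration_cruxToTarget_size_le` for the size bound. [folklore] -/
theorem monotoneRestoration_cruxToTarget_proof : CruxToTarget := by
  unfold CruxToTarget MonotoneRestorationQP SensitiveBridge DenseSubtraction NonnegRestorationQP
  intro hMR hSB hDS h hsymm hVP
  obtain ⟨c₁, hc₁⟩ := hSB h hsymm hVP
  choose d ε hε hd g hg_map hg_deg hg_symm hg_cx using hc₁
  obtain ⟨c₂, hc₂⟩ := hMR g hg_symm ⟨c₁, fun n => ⟨hg_deg n, hg_cx n⟩⟩
  obtain ⟨c₃, hc₃⟩ := monotoneRestoration_cruxToTarget_size_le c₁ c₂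
  refine ⟨c₃, fun n => ?_⟩
  obtain ⟨G, inst, C, hCsymm, hCeval, hCcard⟩ := hc₂ n
  obtain ⟨G', inst', C', hC'symm, hC'eval, hC'card⟩ :=
    hDS n (d n) (ε n) (hε n).ne'
      (MvPolynomial.map (Complex.ofRealHom.comp NNReal.toRealHom) (h n)) G C hCsymm
      (hCeval.trans (hg_map n))
  refine ⟨G', inst', C', hC'symm, hC'eval, ?_⟩
  calc Fintype.card G' ≤ Fintype.card G + d n + n * n + 16 := hC'card
    _ ≤ 2 ^ ((Nat.log 2 n + c₂) ^ c₂) + (n + 2) ^ c₁ + n * n + 16 :=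
        Nat.add_le_add_right (Nat.add_le_add_right (Nat.add_le_add hCcard (hd n)) _) _
    _ ≤ 2 ^ ((Nat.log 2 n + c₃) ^ c₃) := hc₃ n

end Summit.ValiantsHypothesis.ValiantsHypothesis.Theorems
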